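import Literature.NumberTheory.Automorphic.RamifiedPlaceEisensteinBasis             -- ★ B-p17 (g25): `valued_toPlace_eq_sq_of_ramified` (`|ι x|_w = |x|_v²`); ⊇ ★ B-p08 (W1c) `UnitaryTwoRamifiedTreeAction` (`eq_of_sq_eq_sq`, descent at the place)
import Literature.NumberTheory.LocalFields.UnramifiedQuadraticFixedSquares          -- ★ Hensel `isSquare_coe_of_isUnit_of_isSquare_residue`, bridge `v_eq_one_iff_valuation_eq_one`
import Mathlib.NumberTheory.LegendreSymbol.QuadraticChar.Basic
import HarnessLib

/-!
# The projective descent of `U(Φ₂)(L_w)` at a TAME-RAMIFIED place: trace ∕ determinant ∕ DISCRIMINANT under `d·u·d⁻¹ = s·ι(g)`, and the PARITY DICHOTOMY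
# `|tr² − 4det|_w(u) = exp(−2N)` ⟹ `N` even: `tr² g − 4 det g = ε₀·z²`, `N` odd: `= π₁·z²`, `|z∕tr g|_v = |ϖ_v|^{⌊N∕2⌋}` (Serre, *Local Fields* XIV §4; Labesse–Langlands 1979 §2)

Topic `NumberTheory/Automorphic`; namespace `Literature.NumberTheory.Automorphic.UnitaryGroup`.  THEOREMS ONLY (no definition, no instance, no notation, no named fact, no
`sorry`); kernel lane `--supports stmt-HodgeConjecture-24833`.  Cell `pub/hodgecm-mathlib` (D-0151), crux H413; «S3-ram» seeding wave (LEAD F0P3a-plan (g12) T11-62; owner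
F0P3a-p06 (g15)); seat A-p12 (g23).  Organ «TYPE-(2) DESCENT PARITY» = the hypothesis-supplier of ★ p847013 ∕ p847040 ∕ p847070 (`htr hdet ht hz hD hn`): it turns the
type-(2) tokens of the P-2-ram skeleton (α₂) — `hirr` (no root of `χ_{u}` in `L_w`) and the EVEN discriminant depth `|tr² − 4det|_w = exp(−2N)` — into the square-class data of
the DESCENDED element `g ∈ GL₂(L⁺_v)` (★ (W1) `exists_conj_diagonal_eq_smul_map_toPlace`: `diag(1,α)·u·diag(1,α)⁻¹ = s·ι(g)`), and proves this seat's parity finding (ref5 R-231 ∕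
R-257 (2)): `N` EVEN ⟺ `tr² g − 4 det g ∈ ε₀·(L⁺_v)^{×2}` (eigen-ratio field UNRAMIFIED, sub-type 2u), `N` ODD ⟺ `∈ π₁·(L⁺_v)^{×2}` (sub-type 2r).
HONEST LABEL: HC_CM is proved only modulo the cell's 2 remaining named inputs (hLiu418 24832, h413 24833) until rung 0 closes; nothing printed is asserted here — local algebra.

THE MATHEMATICS.  (§1, any fields `ι : F →+* E`) from `diag(1,α)·U·diag(1,α⁻¹) = s·(G.map ι)`: `tr U = s·ι(tr G)`, `det U = s²·ι(det G)`, `tr²U − 4det U = s²·ι(tr²G − 4det G)`; and if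
`tr²G − 4det G = y²` is a square in `F` then `s·ι(tr G + y)∕2` is a ROOT of `χ_U` (`2 ≠ 0`).  (§2, `w ∣ v` tamely ramified, `|ι x|_w = |x|_v²`, ★ `valued_toPlace_eq_sq_of_ramified`) with `|det U|_w = 1`
(unitarity): `|tr²U − 4det U|_w·|det G|_v² = |tr²G − 4det G|_v²`; with `|tr U|_w = 1` (deepness, `|2|_w = 1`): `|tr G|_v² = |det G|_v`, `tr G ≠ 0`; with `|tr²U − 4det U|_w = exp(−2N)`:
**`|(tr²G − 4det G)∕tr²G|_v = exp(−N)`**.  (§3, in `L⁺_v`) for `|D∕t²| = exp(−N)`: `N = 2n+1` ⟹ `D = π₁z²`, `|π₁| = |ϖ_v|`, `z = tϖ_vⁿ`; `N = 2n`, `D` NOT a square, `ε₀` a unit of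
non-square residue ⟹ `D = ε₀z²` with `|z∕t| = |ϖ_v|ⁿ` (the unit `D∕(t²ϖ_v^{2n})` has non-square residue — else HENSEL ★ makes `D` a square — and two non-squares of the residue field
multiply to a square, Mathlib `quadraticChar`).  (§4) the package at the place for a `u` with a descent representative: `hirr` ⟹ `tr²g − 4det g` is not a square in `L⁺_v` (§1's root).

## References
* [Serre1979] J.-P. Serre, *Local Fields*, GTM 67 (1979): Ch. XIV §4 (square classes of a local field, `p` odd); Ch. II §3 (Hensel).
* [LabesseLanglands1979] J.-P. Labesse, R. P. Langlands, *L-indistinguishability for SL(2)*, Canad. J. Math. 31 (1979): §2 p. 8 (the three quadratic tori).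
* [Tits1979] J. Tits, *Reductive groups over local fields*, PSPM 33.1 (1979): §3.9.
-/

set_option autoImplicit false

noncomputable section

open scoped WithZero ValuativeRel Matrix MatrixGroups
open Matrix WithZero ValuativeRel NumberField IsDedekindDomain Polynomial

namespace Literature.NumberTheory.Automorphic.UnitaryGroup

open Literature.NumberTheory.Automorphic Literature.NumberTheory.LocalFields

/-! ## §1 Trace, determinant, discriminant and a root under the projective descent (any fields) -/

section Algebra

variable {F E : Type*} [Field F] [Field E] (ι : F →+* E) {α s : E} {U : Matrix (Fin 2) (Fin 2) E} {G : Matrix (Fin 2) (Fin 2) F}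

/-- `tr (diag(1,α)·U·diag(1,α⁻¹)) = tr U` and `= s·ι(tr G)`: **`tr U = s·ι(tr G)`** (`α ≠ 0`). [cite: Serre1979, Ch. XIV §4] -/
theorem trace_eq_smul_of_descent (hα0 : α ≠ 0) (hsg : Matrix.diagonal ![1, α] * U * Matrix.diagonal ![1, α⁻¹] = s • G.map ι) : U.trace = s * ι G.trace := by
  have hU := Matrix.eta_fin_two U
  have hG := Matrix.eta_fin_two G
  have h00 := congrArg (fun M : Matrix (Fin 2) (Fin 2) E => M 0 0) hsg
  have h11 := congrArg (fun M : Matrix (Fin 2) (Fin 2) E => M 1 1) hsg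
  rw [hU] at h00 h11
  simp [Matrix.mul_apply, Matrix.diagonal] at h00 h11
  have h11' : U 1 1 = s * ι (G 1 1) := by rw [← h11]; field_simp
  rw [hU, hG, Matrix.trace_fin_two_of, Matrix.trace_fin_two_of, map_add, mul_add, h00, h11']

/-- **`det U = s²·ι(det G)`** under the descent identity (`α ≠ 0`). [cite: Serre1979, Ch. XIV §4] -/
theorem det_eq_smul_of_descent (hα0 : α ≠ 0) (hsg : Matrix.diagonal ![1, α] * U * Matrix.diagonal ![1, α⁻¹] = s • G.map ι) : U.det = s ^ 2 * ι G.det := by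
  have hU := Matrix.eta_fin_two U
  have hG := Matrix.eta_fin_two G
  have h00 := congrArg (fun M : Matrix (Fin 2) (Fin 2) E => M 0 0) hsg
  have h01 := congrArg (fun M : Matrix (Fin 2) (Fin 2) E => M 0 1) hsg
  have h10 := congrArg (fun M : Matrix (Fin 2) (Fin 2) E => M 1 0) hsg
  have h11 := congrArg (fun M : Matrix (Fin 2) (Fin 2) E => M 1 1) hsg
  rw [hU] at h00 h01 h10 h11
  simp [Matrix.mul_apply, Matrix.diagonal] at h00 h01 h10 h11
  have h01' : U 0 1 = s * ι (G 0 1) * α := by rw [← h01]; field_simp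
  have h10' : U 1 0 = s * ι (G 1 0) * α⁻¹ := by rw [← h10]; field_simp
  have h11' : U 1 1 = s * ι (G 1 1) := by rw [← h11]; field_simp
  rw [hU, hG, Matrix.det_fin_two_of, Matrix.det_fin_two_of, map_sub, map_mul, map_mul, h00, h01', h10', h11']
  field_simp

/-- **`tr²U − 4det U = s²·ι(tr²G − 4det G)`** under the descent identity. [cite: Serre1979, Ch. XIV §4] -/
theorem disc_eq_smul_of_descent (hα0 : α ≠ 0) (hsg : Matrix.diagonal ![1, α] * U * Matrix.diagonal ![1, α⁻¹] = s • G.map ι) :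
    U.trace ^ 2 - 4 * U.det = s ^ 2 * ι (G.trace ^ 2 - 4 * G.det) := by
  rw [trace_eq_smul_of_descent ι hα0 hsg, det_eq_smul_of_descent ι hα0 hsg, map_sub, map_mul, map_pow, map_ofNat]
  ring

/-- **A SQUARE DISCRIMINANT DOWNSTAIRS GIVES A ROOT UPSTAIRS**: if `4·det G = tr²G − y²` (`y ∈ F`) then `s·ι(tr G + y)∕2` is a root of the characteristic polynomial of `U`
(`2 ≠ 0` in `E`).  Contrapositive use: `hirr` (type (2)) forbids `tr²G − 4det G` to be a square in `F`. [cite: Serre1979, Ch. XIV §4] [cite: LabesseLanglands1979, §2 p. 8] -/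
theorem isRoot_charpoly_of_descent_of_sq (h2 : (2 : E) ≠ 0) (hα0 : α ≠ 0) (hsg : Matrix.diagonal ![1, α] * U * Matrix.diagonal ![1, α⁻¹] = s • G.map ι) {y : F}
    (hy : 4 * G.det = G.trace ^ 2 - y ^ 2) : U.charpoly.IsRoot (s * ι (G.trace + y) / 2) := by
  rw [Matrix.charpoly_fin_two, Polynomial.IsRoot.def, trace_eq_smul_of_descent ι hα0 hsg, det_eq_smul_of_descent ι hα0 hsg]
  simp only [eval_add, eval_sub, eval_mul, eval_pow, eval_C, eval_X]
  have hy' : (4 : E) * ι G.det = ι G.trace ^ 2 - ι y ^ 2 := by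
    have h := congrArg ι hy
    rwa [map_mul, map_ofNat, map_sub, map_pow, map_pow] at h
  have h4 : (4 : E) ≠ 0 := by rw [show (4 : E) = 2 * 2 by norm_num]; exact mul_ne_zero h2 h2
  rw [map_add]
  have key : (4 : E) * ((s * (ι G.trace + ι y) / 2) ^ 2 - s * ι G.trace * (s * (ι G.trace + ι y) / 2) + s ^ 2 * ι G.det) = 0 := by
    rw [mul_add, mul_sub, show (4 : E) * (s ^ 2 * ι G.det) = s ^ 2 * (4 * ι G.det) by ring, hy']
    field_simp
    ring
  rcases mul_eq_zero.1 key with h | h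
  · exact absurd h h4
  · exact h

end Algebra

/-! ## §2 Valuations at a tamely ramified place -/

section Place

variable (L : Type) [Field L] [NumberField L] [IsCMField L] (v : HeightOneSpectrum (𝓞 ↥(maximalRealSubfield L)))
  (w : PlacesOver L v) (hw : IsCMField.complexConj L • w.1 = w.1)

include hw in
/-- **THE DISCRIMINANT VALUATION UNDER THE DESCENT** at a ramified place: with `|det U|_w = 1`, `|tr²U − 4det U|_w · |det G|_v² = |tr²G − 4det G|_v²`.
[cite: Serre1979, Ch. XIV §4] [cite: LabesseLanglands1979, §2 p. 8] -/
theorem valued_disc_mul_sq_eq_of_descent (he : v.asIdeal.ramificationIdx' w.1.asIdeal ≠ 1) {α s : w.1.adicCompletion L} (hα0 : α ≠ 0)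
    {U : Matrix (Fin 2) (Fin 2) (w.1.adicCompletion L)} {G : Matrix (Fin 2) (Fin 2) (v.adicCompletion ↥(maximalRealSubfield L))}
    (hsg : Matrix.diagonal ![1, α] * U * Matrix.diagonal ![1, α⁻¹] = s • G.map (toPlace v w)) (hdetU : Valued.v U.det = 1) :
    Valued.v (U.trace ^ 2 - 4 * U.det) * Valued.v G.det ^ 2 = Valued.v (G.trace ^ 2 - 4 * G.det) ^ 2 := by
  rw [disc_eq_smul_of_descent (toPlace v w) hα0 hsg, map_mul, map_pow, valued_toPlace_eq_sq_of_ramified L v w hw he]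
  rw [det_eq_smul_of_descent (toPlace v w) hα0 hsg, map_mul, map_pow, valued_toPlace_eq_sq_of_ramified L v w hw he] at hdetU
  rw [mul_right_comm, hdetU, one_mul]

include hw in
/-- **DEEPNESS DOWNSTAIRS**: with `|det U|_w = 1` and `|tr U|_w = 1`, the descended trace and determinant satisfy `|tr G|_v² = |det G|_v` and `tr G ≠ 0`.
[cite: Serre1979, Ch. XIV §4] -/
theorem valued_trace_sq_eq_valued_det_of_descent (he : v.asIdeal.ramificationIdx' w.1.asIdeal ≠ 1) {α s : w.1.adicCompletion L} (hα0 : α ≠ 0)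
    {U : Matrix (Fin 2) (Fin 2) (w.1.adicCompletion L)} {G : Matrix (Fin 2) (Fin 2) (v.adicCompletion ↥(maximalRealSubfield L))}
    (hsg : Matrix.diagonal ![1, α] * U * Matrix.diagonal ![1, α⁻¹] = s • G.map (toPlace v w)) (hdetU : Valued.v U.det = 1) (htrU : Valued.v U.trace = 1) :
    Valued.v G.trace ^ 2 = Valued.v G.det ∧ G.trace ≠ 0 := by
  rw [det_eq_smul_of_descent (toPlace v w) hα0 hsg, map_mul, map_pow, valued_toPlace_eq_sq_of_ramified L v w hw he] at hdetU
  rw [trace_eq_smul_of_descent (toPlace v w) hα0 hsg, map_mul, valued_toPlace_eq_sq_of_ramified L v w hw he] at htrU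
  have ht0 : G.trace ≠ 0 := by
    intro h; rw [h, map_zero, zero_pow two_ne_zero, mul_zero] at htrU; exact zero_ne_one htrU
  have hs0 : Valued.v s ≠ 0 := by
    intro h; rw [h, zero_mul] at htrU; exact zero_ne_one htrU
  have h1 : Valued.v s ^ 2 * (Valued.v G.trace ^ 2) ^ 2 = 1 := by rw [← mul_pow, htrU, one_pow]
  exact ⟨eq_of_sq_eq_sq (mul_left_cancel₀ (pow_ne_zero 2 hs0) (h1.trans hdetU.symm)), ht0⟩

include hw in
/-- **THE DEPTH DOWNSTAIRS** (HEAD of §2): `|det U|_w = 1`, `|tr U|_w = 1`, `|tr²U − 4det U|_w = exp(−2N)` ⟹ **`|(tr²G − 4det G) ∕ tr²G|_v = exp(−N)`** (and `tr G ≠ 0`).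
[cite: Serre1979, Ch. XIV §4] [cite: LabesseLanglands1979, §2 p. 8] -/
theorem valued_disc_div_trace_sq_of_descent (he : v.asIdeal.ramificationIdx' w.1.asIdeal ≠ 1) {α s : w.1.adicCompletion L} (hα0 : α ≠ 0)
    {U : Matrix (Fin 2) (Fin 2) (w.1.adicCompletion L)} {G : Matrix (Fin 2) (Fin 2) (v.adicCompletion ↥(maximalRealSubfield L))}
    (hsg : Matrix.diagonal ![1, α] * U * Matrix.diagonal ![1, α⁻¹] = s • G.map (toPlace v w)) (hdetU : Valued.v U.det = 1) (htrU : Valued.v U.trace = 1)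
    {N : ℕ} (hN : Valued.v (U.trace ^ 2 - 4 * U.det) = WithZero.exp (-((2 * N : ℕ) : ℤ))) :
    G.trace ≠ 0 ∧ Valued.v ((G.trace ^ 2 - 4 * G.det) / G.trace ^ 2) = WithZero.exp (-(N : ℤ)) := by
  obtain ⟨htd, ht0⟩ := valued_trace_sq_eq_valued_det_of_descent L v w hw he hα0 hsg hdetU htrU
  have hP := valued_disc_mul_sq_eq_of_descent L v w hw he hα0 hsg hdetU
  rw [hN, ← htd] at hP
  refine ⟨ht0, ?_⟩
  have hvt : Valued.v G.trace ≠ 0 := (Valuation.ne_zero_iff _).2 ht0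
  have hsq : (WithZero.exp (-(N : ℤ)) * Valued.v G.trace ^ 2) ^ 2 = Valued.v (G.trace ^ 2 - 4 * G.det) ^ 2 := by
    rw [← hP, mul_pow, ← WithZero.exp_nsmul]
    congr 2
    push_cast
    ring
  have h := eq_of_sq_eq_sq hsq
  rw [map_div₀, map_pow, ← h, mul_div_assoc, div_self (pow_ne_zero 2 hvt), mul_one]

include hw in
/-- **THE DISCRIMINANT DEPTH UPSTAIRS IS EVEN** (ref5 (g4) R-259∕R-262 junction corollary): with a descent representative and `|det U|_w = 1`, if `|tr²U − 4det U|_w ≤ 1` and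
`tr²U − 4det U ≠ 0` then `|tr²U − 4det U|_w = exp(−2N)` for some `N : ℕ` — by :118 the value is the SQUARE `(|tr²G − 4det G|_v · |det G|_v⁻¹)²` in `ℤᵐ⁰`.  (So the P-2-ram
skeleton's depth token `∀ N, |disc| = exp(−2N) →` loses nothing at a ramified place.) [cite: Serre1979, Ch. XIV §4] -/
theorem exists_valued_disc_eq_exp_neg_even_of_descent (he : v.asIdeal.ramificationIdx' w.1.asIdeal ≠ 1) {α s : w.1.adicCompletion L} (hα0 : α ≠ 0)
    {U : Matrix (Fin 2) (Fin 2) (w.1.adicCompletion L)} {G : Matrix (Fin 2) (Fin 2) (v.adicCompletion ↥(maximalRealSubfield L))}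
    (hsg : Matrix.diagonal ![1, α] * U * Matrix.diagonal ![1, α⁻¹] = s • G.map (toPlace v w)) (hdetU : Valued.v U.det = 1)
    (hle : Valued.v (U.trace ^ 2 - 4 * U.det) ≤ 1) (hne : U.trace ^ 2 - 4 * U.det ≠ 0) :
    ∃ N : ℕ, Valued.v (U.trace ^ 2 - 4 * U.det) = WithZero.exp (-((2 * N : ℕ) : ℤ)) := by
  have hP := valued_disc_mul_sq_eq_of_descent L v w hw he hα0 hsg hdetU
  have hdet' := hdetU
  rw [det_eq_smul_of_descent (toPlace v w) hα0 hsg, map_mul, map_pow, valued_toPlace_eq_sq_of_ramified L v w hw he] at hdet'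
  have hd0 : Valued.v G.det ≠ 0 := by
    intro h; rw [h, zero_pow two_ne_zero, mul_zero] at hdet'; exact zero_ne_one hdet'
  have hv0 : Valued.v (U.trace ^ 2 - 4 * U.det) ≠ 0 := (Valuation.ne_zero_iff _).2 hne
  set x : ℤᵐ⁰ := Valued.v (G.trace ^ 2 - 4 * G.det) * (Valued.v G.det)⁻¹ with hxdef
  have hx : Valued.v (U.trace ^ 2 - 4 * U.det) = x ^ 2 := by
    rw [hxdef, mul_pow, inv_pow, ← hP, mul_inv_cancel_right₀ (pow_ne_zero 2 hd0)]
  have hx0 : x ≠ 0 := by intro h; rw [h, zero_pow two_ne_zero] at hx; exact hv0 hx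
  obtain ⟨m, hxm⟩ : ∃ m : ℤ, x = WithZero.exp m := ⟨_, (WithZero.exp_log hx0).symm⟩
  have hm : m ≤ 0 := by
    have h1 : x ^ 2 ≤ 1 := hx ▸ hle
    have h2 : x ≤ 1 := by
      by_contra hlt
      rw [not_le] at hlt
      exact absurd h1 (not_le.2 (one_lt_pow₀ hlt two_ne_zero))
    rwa [hxm, ← WithZero.exp_zero, WithZero.exp_le_exp] at h2
  refine ⟨(-m).toNat, ?_⟩
  rw [hx, hxm, ← WithZero.exp_nsmul]
  congr 1
  simp only [nsmul_eq_mul]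
  push_cast
  rw [Int.toNat_of_nonneg (by omega)]
  ring

end Place

/-! ## §3 The square-class dichotomy in `L⁺_v` for `|D ∕ t²|_v = exp(−N)` -/

section Dichotomy

variable (L : Type) [Field L] [NumberField L] (v : HeightOneSpectrum (𝓞 ↥(maximalRealSubfield L)))

/-- **ODD DEPTH ⟹ RAMIFIED SQUARE CLASS**: if `|D∕t²|_v = exp(−(2n+1))` (`t ≠ 0`, `|ϖ|_v = exp(−1)`) then `D = π₁·z²` with `|π₁| = |ϖ|`, `z = t·ϖⁿ ≠ 0`, `|z·t⁻¹| = |ϖ|ⁿ`.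
[cite: Serre1979, Ch. XIV §4] -/
theorem exists_eq_uniformizer_mul_sq_of_odd {D t ϖ : v.adicCompletion ↥(maximalRealSubfield L)} (ht : t ≠ 0) (hϖ : Valued.v ϖ = WithZero.exp (-1 : ℤ)) {n : ℕ}
    (hN : Valued.v (D / t ^ 2) = WithZero.exp (-((2 * n + 1 : ℕ) : ℤ))) :
    ∃ π₁ z : v.adicCompletion ↥(maximalRealSubfield L), Valued.v π₁ = Valued.v ϖ ∧ z ≠ 0 ∧ D = π₁ * z ^ 2 ∧ Valued.v (z * t⁻¹) = Valued.v ϖ ^ n := by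
  have hϖ0 : ϖ ≠ 0 := fun h => by rw [h, map_zero] at hϖ; exact WithZero.coe_ne_zero hϖ.symm
  have hvn : Valued.v ϖ ^ n ≠ 0 := pow_ne_zero n ((Valuation.ne_zero_iff _).2 hϖ0)
  have hz0 : t * ϖ ^ n ≠ 0 := mul_ne_zero ht (pow_ne_zero n hϖ0)
  refine ⟨D / (t * ϖ ^ n) ^ 2, t * ϖ ^ n, ?_, hz0, ?_, ?_⟩
  · -- `|D∕(tϖⁿ)²| · (|ϖ|ⁿ)² = |D∕t²| = exp(−(2n+1)) = |ϖ|·(|ϖ|ⁿ)²`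
    have hprod : D / (t * ϖ ^ n) ^ 2 * (ϖ ^ n) ^ 2 = D / t ^ 2 := by field_simp
    have hL : Valued.v (D / (t * ϖ ^ n) ^ 2) * (Valued.v ϖ ^ n) ^ 2 = Valued.v (D / t ^ 2) := by rw [← map_pow, ← map_pow, ← map_mul, hprod]
    have hR : Valued.v ϖ * (Valued.v ϖ ^ n) ^ 2 = WithZero.exp (-((2 * n + 1 : ℕ) : ℤ)) := by
      rw [hϖ, ← pow_mul, ← pow_succ', ← WithZero.exp_nsmul]
      congr 1
      simp only [nsmul_eq_mul]
      push_cast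
      ring
    exact mul_right_cancel₀ (pow_ne_zero 2 hvn) (hL.trans (hN.trans hR.symm))
  · field_simp
  · rw [mul_comm t, mul_inv_cancel_right₀ ht, map_pow]

/-- A unit of `L⁺_v` whose residue is NOT a square: spelling `hns : ∀ b, |b| ≤ 1 → |b² − ε₀| = 1` (the valuation form of ★ `QuadraticUnramifiedOrderUnitIndex`'s `∀ b, b² − ε ∈ 𝒪^×`)
implies `|ε₀| = 1` and `¬ IsSquare (residue ε₀)`. [cite: Serre1979, Ch. XIV §4] -/
theorem not_isSquare_residue_of_hns {ε₀ : v.adicCompletion ↥(maximalRealSubfield L)} (hε₀ : Valued.v ε₀ ≤ 1)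
    (hns : ∀ b : v.adicCompletion ↥(maximalRealSubfield L), Valued.v b ≤ 1 → Valued.v (b ^ 2 - ε₀) = 1) :
    Valued.v ε₀ = 1 ∧ ¬ IsSquare (IsLocalRing.residue 𝒪[v.adicCompletion ↥(maximalRealSubfield L)] ⟨ε₀, (v_le_one_iff_mem_integer ε₀).1 hε₀⟩) := by
  refine ⟨?_, ?_⟩
  · have h := hns 0 (by rw [map_zero]; exact zero_le)
    rwa [zero_pow two_ne_zero, zero_sub, Valuation.map_neg] at h
  · rintro ⟨bbar, hb⟩
    obtain ⟨b, rfl⟩ := IsLocalRing.residue_surjective bbar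
    have h0 : IsLocalRing.residue 𝒪[v.adicCompletion ↥(maximalRealSubfield L)] (b * b - ⟨ε₀, (v_le_one_iff_mem_integer ε₀).1 hε₀⟩) = 0 := by
      rw [map_sub, map_mul, ← hb, sub_self]
    have hlt := (residue_eq_zero_iff_valuation_lt_one _).1 h0
    have hb1 : Valued.v (b : v.adicCompletion ↥(maximalRealSubfield L)) ≤ 1 := (v_le_one_iff_mem_integer _).2 b.2
    have h1 := hns b hb1
    rw [pow_two] at h1
    have hlt' : Valued.v ((b : v.adicCompletion ↥(maximalRealSubfield L)) * b - ε₀) < 1 := (v_lt_one_iff_valuation_lt_one _).2 (by simpa using hlt)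
    rw [h1] at hlt'
    exact lt_irrefl _ hlt'

/-- **EVEN DEPTH ⟹ UNRAMIFIED (NON-SQUARE UNIT) SQUARE CLASS**: if `|D∕t²|_v = exp(−2n)` (`t ≠ 0`, `|ϖ|_v = exp(−1)`, `|2|_v = 1`), `D` is NOT a square in `L⁺_v`, and `ε₀` is a
unit of non-square residue (`hns`), then `D = ε₀·z²` with `z ≠ 0` and `|z·t⁻¹| = |ϖ|ⁿ`.  (The unit `D∕(tϖⁿ)²` has non-square residue — else HENSEL ★
`isSquare_coe_of_isUnit_of_isSquare_residue` makes `D` a square —, two non-squares of the residue field multiply to a square (`quadraticChar`), and Hensel again.)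
[cite: Serre1979, Ch. XIV §4; Ch. II §3] -/
theorem exists_eq_nonsquare_unit_mul_sq_of_even [Finite (IsLocalRing.ResidueField 𝒪[v.adicCompletion ↥(maximalRealSubfield L)])]
    (h2 : Valued.v (2 : v.adicCompletion ↥(maximalRealSubfield L)) = 1) {D t ϖ : v.adicCompletion ↥(maximalRealSubfield L)} (ht : t ≠ 0)
    (hϖ : Valued.v ϖ = WithZero.exp (-1 : ℤ)) {n : ℕ} (hN : Valued.v (D / t ^ 2) = WithZero.exp (-((2 * n : ℕ) : ℤ))) (hD : ¬ IsSquare D)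
    {ε₀ : v.adicCompletion ↥(maximalRealSubfield L)} (hε₀ : Valued.v ε₀ ≤ 1) (hns : ∀ b : v.adicCompletion ↥(maximalRealSubfield L), Valued.v b ≤ 1 → Valued.v (b ^ 2 - ε₀) = 1) :
    ∃ z : v.adicCompletion ↥(maximalRealSubfield L), z ≠ 0 ∧ D = ε₀ * z ^ 2 ∧ Valued.v (z * t⁻¹) = Valued.v ϖ ^ n := by
  classical
  have hϖ0 : ϖ ≠ 0 := fun h => by rw [h, map_zero] at hϖ; exact WithZero.coe_ne_zero hϖ.symm
  have hvn : Valued.v ϖ ^ n ≠ 0 := pow_ne_zero n ((Valuation.ne_zero_iff _).2 hϖ0)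
  have hy0 : t * ϖ ^ n ≠ 0 := mul_ne_zero ht (pow_ne_zero n hϖ0)
  obtain ⟨hε1, hεns⟩ := not_isSquare_residue_of_hns L v hε₀ hns
  have hε0' : ε₀ ≠ 0 := fun h => by rw [h, map_zero] at hε1; exact zero_ne_one hε1
  -- the unit `w₀ = D ∕ (tϖⁿ)²`
  set w₀ : v.adicCompletion ↥(maximalRealSubfield L) := D / (t * ϖ ^ n) ^ 2 with hw₀
  have hprod : w₀ * (ϖ ^ n) ^ 2 = D / t ^ 2 := by rw [hw₀]; field_simp
  have hw1 : Valued.v w₀ = 1 := by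
    have hL : Valued.v w₀ * (Valued.v ϖ ^ n) ^ 2 = Valued.v (D / t ^ 2) := by rw [← map_pow, ← map_pow, ← map_mul, hprod]
    have hR : (1 : ℤᵐ⁰) * (Valued.v ϖ ^ n) ^ 2 = WithZero.exp (-((2 * n : ℕ) : ℤ)) := by
      rw [one_mul, hϖ, ← pow_mul, ← WithZero.exp_nsmul]
      congr 1
      simp only [nsmul_eq_mul]
      push_cast
      ring
    exact mul_right_cancel₀ (pow_ne_zero 2 hvn) (hL.trans (hN.trans hR.symm))
  have hDw : D = w₀ * (t * ϖ ^ n) ^ 2 := by rw [hw₀]; field_simp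
  -- Hensel data
  have h2' : valuation (v.adicCompletion ↥(maximalRealSubfield L)) (2 : v.adicCompletion ↥(maximalRealSubfield L)) = 1 := (v_eq_one_iff_valuation_eq_one _).1 h2
  have hw₀O : w₀ ∈ 𝒪[v.adicCompletion ↥(maximalRealSubfield L)] := (v_le_one_iff_mem_integer _).1 hw1.le
  have hw₀u : IsUnit (⟨w₀, hw₀O⟩ : 𝒪[v.adicCompletion ↥(maximalRealSubfield L)]) := by
    rw [Valuation.Integers.isUnit_iff_valuation_eq_one (Valuation.integer.integers (valuation (v.adicCompletion ↥(maximalRealSubfield L))))]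
    exact (v_eq_one_iff_valuation_eq_one w₀).1 hw1
  have hε₀u : IsUnit (⟨ε₀, (v_le_one_iff_mem_integer ε₀).1 hε₀⟩ : 𝒪[v.adicCompletion ↥(maximalRealSubfield L)]) := by
    rw [Valuation.Integers.isUnit_iff_valuation_eq_one (Valuation.integer.integers (valuation (v.adicCompletion ↥(maximalRealSubfield L))))]
    exact (v_eq_one_iff_valuation_eq_one ε₀).1 hε1
  -- the residue of `w₀` is not a square (else `D` would be a square)
  have hwns : ¬ IsSquare (IsLocalRing.residue 𝒪[v.adicCompletion ↥(maximalRealSubfield L)] ⟨w₀, hw₀O⟩) := by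
    intro hsq
    obtain ⟨r, hr⟩ := UnramifiedQuadraticNorm.isSquare_coe_of_isUnit_of_isSquare_residue h2' ⟨w₀, hw₀O⟩ hw₀u hsq
    exact hD ⟨r * (t * ϖ ^ n), by rw [hDw]; simp only at hr; rw [hr]; ring⟩
  -- two non-squares of the residue field multiply to a square
  haveI : Fintype (IsLocalRing.ResidueField 𝒪[v.adicCompletion ↥(maximalRealSubfield L)]) := Fintype.ofFinite _
  have hwbar0 : IsLocalRing.residue 𝒪[v.adicCompletion ↥(maximalRealSubfield L)] ⟨w₀, hw₀O⟩ ≠ 0 := (IsLocalRing.residue_ne_zero_iff_isUnit _).2 hw₀u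
  have hεbar0 : IsLocalRing.residue 𝒪[v.adicCompletion ↥(maximalRealSubfield L)] ⟨ε₀, (v_le_one_iff_mem_integer ε₀).1 hε₀⟩ ≠ 0 := (IsLocalRing.residue_ne_zero_iff_isUnit _).2 hε₀u
  have hsq : IsSquare (IsLocalRing.residue 𝒪[v.adicCompletion ↥(maximalRealSubfield L)] (⟨w₀, hw₀O⟩ * ⟨ε₀, (v_le_one_iff_mem_integer ε₀).1 hε₀⟩)) := by
    rw [map_mul, ← quadraticChar_one_iff_isSquare (mul_ne_zero hwbar0 hεbar0), map_mul,
      (quadraticChar_neg_one_iff_not_isSquare).2 hwns, (quadraticChar_neg_one_iff_not_isSquare).2 hεns]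
    norm_num
  obtain ⟨r₁, hr₁⟩ := UnramifiedQuadraticNorm.isSquare_coe_of_isUnit_of_isSquare_residue h2' _ (hw₀u.mul hε₀u) hsq
  have hr₁' : w₀ * ε₀ = r₁ * r₁ := by simpa using hr₁
  have hr₁v : Valued.v r₁ = 1 := by
    have h : Valued.v (r₁ * r₁) = 1 := by rw [← hr₁', map_mul, hw1, hε1, mul_one]
    rw [map_mul, ← pow_two] at h
    rcases pow_eq_one_iff.1 h with h1 | h1
    · exact h1
    · exact absurd h1 two_ne_zero
  refine ⟨r₁ * (t * ϖ ^ n) * ε₀⁻¹, mul_ne_zero (mul_ne_zero ?_ hy0) (inv_ne_zero hε0'), ?_, ?_⟩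
  · intro h; rw [h, map_zero] at hr₁v; exact zero_ne_one hr₁v
  · rw [hDw]
    have hw' : w₀ = r₁ * r₁ * ε₀⁻¹ := by rw [← hr₁']; field_simp
    rw [hw']
    field_simp
  · rw [show r₁ * (t * ϖ ^ n) * ε₀⁻¹ * t⁻¹ = r₁ * ε₀⁻¹ * ϖ ^ n by field_simp, map_mul, map_mul, map_inv₀, hr₁v, hε1, inv_one, one_mul, one_mul,
      map_pow]

end Dichotomy

/-! ## §4 The package at the place: `hirr` forbids a square discriminant downstairs -/

section Package

variable (L : Type) [Field L] [NumberField L] [IsCMField L] (v : HeightOneSpectrum (𝓞 ↥(maximalRealSubfield L)))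
  (w : PlacesOver L v) (hw : IsCMField.complexConj L • w.1 = w.1)

omit [IsCMField L] in
/-- **`hirr` ⟹ `tr²g − 4det g` IS NOT A SQUARE IN `L⁺_v`** (for any descent representative; `2 ≠ 0` in `L_w`): a square root `y` downstairs gives the root `s·ι(t + y)∕2` of `χ_U`
upstairs (§1). [cite: Serre1979, Ch. XIV §4] [cite: LabesseLanglands1979, §2 p. 8] -/
theorem not_isSquare_disc_of_descent_of_not_exists_isRoot (h2 : (2 : w.1.adicCompletion L) ≠ 0) {α s : w.1.adicCompletion L} (hα0 : α ≠ 0)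
    {U : Matrix (Fin 2) (Fin 2) (w.1.adicCompletion L)} {G : Matrix (Fin 2) (Fin 2) (v.adicCompletion ↥(maximalRealSubfield L))}
    (hsg : Matrix.diagonal ![1, α] * U * Matrix.diagonal ![1, α⁻¹] = s • G.map (toPlace v w))
    (hirr : ¬ ∃ x : w.1.adicCompletion L, U.charpoly.IsRoot x) : ¬ IsSquare (G.trace ^ 2 - 4 * G.det) := by
  rintro ⟨y, hy⟩
  exact hirr ⟨_, isRoot_charpoly_of_descent_of_sq (toPlace v w) h2 hα0 hsg (y := y) (by rw [← pow_two] at hy; linear_combination -hy)⟩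

end Package

end Literature.NumberTheory.Automorphic.UnitaryGroup

end
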